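import Summits.AtomisticToContinuum.Crystallization.Theorems.ChargedEnergyGapStabilityReductionB
import HarnessLib

/-!
# «StabilityReduction» P-K STAB-61 typed and reduced (lens-3 g61) — part 3 of 3 (sequel of `…ChargedEnergyGapStabilityReductionB`)

Split for the 400-line cap by the landing lane (hand-2 g31); the module docstring of part 1 (`…ChargedEnergyGapStabilityReductionA`) describes the whole node.  Same namespace; all FQNs unchanged.
0 sorry; standard axioms.
-/

noncomputable section
open scoped Classical
open Literature.MathematicalPhysics.StatisticalMechanics
open Literature.Geometry.DiscreteGeometry
open Summit.AtomisticToContinuum.Crystallization.Theses.PricedLinkCensus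
open Summit.AtomisticToContinuum.Crystallization.Theorems.ChargedEnergyGapNegative

namespace Summit.AtomisticToContinuum.Crystallization.Theorems.ChargedEnergyGapChartDial

namespace Fcc

/-! ## §K7 The CUBIC (scalar) form of the inequality: `StabIneq μ₀ b ⟸ 4 μ₀ N₂ ≤ min(P₄ − P₂₂, 2 P₂₂)` -/

section Scalars

variable {b : ℝ}

/-- The fourth MOMENT SUMS `T_ijkl(b) = Σ' coef(n)·(b n_i)(b n_j)(b n_k)(b n_l)` of the stiffness weights. -/
def Tm (b : ℝ) (i j k l : Fin 3) : ℝ :=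
  ∑' n : D3, coef b n * (((n.1 i : ℝ)) * b * (((n.1 j : ℝ)) * b) * (((n.1 k : ℝ)) * b) * (((n.1 l : ℝ)) * b))

/-- `P₄ = T₀₀₀₀` (numerically `≈ 16.06` at `b = a₀`) and `P₂₂ = T₀₀₁₁` (`≈ 9.19`). -/
def P4 (b : ℝ) : ℝ := Tm b 0 0 0 0
/-- `P22` (docstring added by the landing lane; see the module docstring). [formal bookkeeping] -/
def P22 (b : ℝ) : ℝ := Tm b 0 0 1 1

/-- `abs_coef_le` (docstring added by the landing lane; see the module docstring). [formal bookkeeping] -/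
theorem abs_coef_le (b : ℝ) (n : D3) : |coef b n| ≤ 14 * ((len b n)⁻¹) ^ 16 + 8 * ((len b n)⁻¹) ^ 10 := by
  unfold coef
  have h16 : 0 ≤ (len b n)⁻¹ ^ 16 := by positivity
  have h10 : 0 ≤ (len b n)⁻¹ ^ 10 := by positivity
  exact (abs_sub _ _).trans (by rw [abs_of_nonneg (by positivity), abs_of_nonneg (by positivity)])

/-- `summable_Tm` (docstring added by the landing lane; see the module docstring). [formal bookkeeping] -/
theorem summable_Tm (hb : 0 < b) (i j k l : Fin 3) : Summable fun n : D3 =>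
    coef b n * (((n.1 i : ℝ)) * b * (((n.1 j : ℝ)) * b) * (((n.1 k : ℝ)) * b) * (((n.1 l : ℝ)) * b)) := by
  refine Summable.of_norm_bounded (((summable_inv_len_pow b hb (by norm_num : 3 < 12)).mul_left 14).add
    ((summable_inv_len_pow b hb (by norm_num : 3 < 6)).mul_left 8)) fun n => ?_
  have hl := len_pos b hb n
  have hi := abs_coord_le_len b hb n i
  have hj := abs_coord_le_len b hb n j
  have hk := abs_coord_le_len b hb n k
  have hl' := abs_coord_le_len b hb n l
  rw [Real.norm_eq_abs, abs_mul, abs_mul, abs_mul, abs_mul]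
  have h4 : |((n.1 i : ℝ)) * b| * |((n.1 j : ℝ)) * b| * |((n.1 k : ℝ)) * b| * |((n.1 l : ℝ)) * b| ≤ len b n ^ 4 := by
    calc _ ≤ len b n * len b n * len b n * len b n :=
          mul_le_mul (mul_le_mul (mul_le_mul hi hj (abs_nonneg _) hl.le) hk (abs_nonneg _) (by positivity)) hl' (abs_nonneg _)
            (by positivity)
      _ = len b n ^ 4 := by ring
  calc |coef b n| * (|((n.1 i : ℝ)) * b| * |((n.1 j : ℝ)) * b| * |((n.1 k : ℝ)) * b| * |((n.1 l : ℝ)) * b|)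
      ≤ (14 * ((len b n)⁻¹) ^ 16 + 8 * ((len b n)⁻¹) ^ 10) * len b n ^ 4 :=
        mul_le_mul (abs_coef_le b n) h4 (by positivity) (by positivity)
    _ = 14 * ((len b n)⁻¹) ^ 12 + 8 * ((len b n)⁻¹) ^ 6 := by field_simp

/-- ★ `Qsum` IS A QUADRATIC FORM IN `M` WITH COEFFICIENTS `T_ijkl`. -/
theorem Qsum_eq_Tm (hb : 0 < b) (M : Fin 3 → Fin 3 → ℝ) : Qsum M b = ∑ i, ∑ j, ∑ k, ∑ l, M i j * M k l * Tm b i j k l := by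
  unfold Qsum
  have h1 : ∀ n : D3, coef b n * qf M b n.1 ^ 2 = ∑ i, ∑ j, ∑ k, ∑ l,
      M i j * M k l * (coef b n * (((n.1 i : ℝ)) * b * (((n.1 j : ℝ)) * b) * (((n.1 k : ℝ)) * b) * (((n.1 l : ℝ)) * b))) := by
    intro n
    rw [qf, sq, Finset.sum_mul, Finset.mul_sum]
    refine Finset.sum_congr rfl fun i _ => ?_
    rw [Finset.sum_mul, Finset.mul_sum]
    refine Finset.sum_congr rfl fun j _ => ?_
    rw [Finset.mul_sum, Finset.mul_sum]
    refine Finset.sum_congr rfl fun k _ => ?_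
    rw [Finset.mul_sum, Finset.mul_sum]
    refine Finset.sum_congr rfl fun l _ => ?_
    ring
  simp_rw [h1]
  rw [Summable.tsum_finsetSum (fun i _ => summable_sum fun j _ => summable_sum fun k _ => summable_sum fun l _ =>
    (summable_Tm hb i j k l).mul_left _)]
  refine Finset.sum_congr rfl fun i _ => ?_
  rw [Summable.tsum_finsetSum (fun j _ => summable_sum fun k _ => summable_sum fun l _ => (summable_Tm hb i j k l).mul_left _)]
  refine Finset.sum_congr rfl fun j _ => ?_
  rw [Summable.tsum_finsetSum (fun k _ => summable_sum fun l _ => (summable_Tm hb i j k l).mul_left _)]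
  refine Finset.sum_congr rfl fun k _ => ?_
  rw [Summable.tsum_finsetSum (fun l _ => (summable_Tm hb i j k l).mul_left _)]
  refine Finset.sum_congr rfl fun l _ => ?_
  rw [tsum_mul_left]
  rfl

/-- `Tm` only depends on the product of the four coordinates. -/
theorem Tm_congr (b : ℝ) {i j k l i' j' k' l' : Fin 3}
    (h : ∀ n : D3, ((n.1 i : ℝ)) * b * (((n.1 j : ℝ)) * b) * (((n.1 k : ℝ)) * b) * (((n.1 l : ℝ)) * b) =
      ((n.1 i' : ℝ)) * b * (((n.1 j' : ℝ)) * b) * (((n.1 k' : ℝ)) * b) * (((n.1 l' : ℝ)) * b)) :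
    Tm b i j k l = Tm b i' j' k' l' :=
  tsum_congr fun n => by rw [h n]

/-- The sign character of the flip of coordinate `s`. -/
def sgn (s m : Fin 3) : ℤ := if m = s then -1 else 1

/-- `cast_negCoord` (docstring added by the landing lane; see the module docstring). [formal bookkeeping] -/
theorem cast_negCoord (s m : Fin 3) (n : Fin 3 → ℤ) : ((negCoord s n m : ℤ) : ℝ) = (sgn s m : ℝ) * (n m : ℝ) := by
  unfold negCoord sgn
  by_cases h : m = s <;> simp [h]

/-- ★ SIGN-FLIP COVARIANCE: `T_ijkl = ε_i ε_j ε_k ε_l · T_ijkl` for the flip of any one coordinate. -/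
theorem Tm_neg (b : ℝ) (s i j k l : Fin 3) : Tm b i j k l = ((sgn s i * sgn s j * sgn s k * sgn s l : ℤ) : ℝ) * Tm b i j k l := by
  unfold Tm
  conv_lhs => rw [← (negEquiv s).tsum_eq]
  rw [← tsum_mul_left]
  refine tsum_congr fun n => ?_
  have hc : coef b (negEquiv s n) = coef b n := by simp only [coef, len_negEquiv]
  have hm : ∀ m, (((negEquiv s n).1 m : ℝ)) = (sgn s m : ℝ) * (n.1 m : ℝ) := fun m => cast_negCoord s m n.1
  rw [hc, hm, hm, hm, hm]
  push_cast
  ring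

/-- ★ SWAP COVARIANCE: `T_ijkl = T_{σi σj σk σl}` for the transposition `σ = (0 s)`. -/
theorem Tm_swap (b : ℝ) (s i j k l : Fin 3) :
    Tm b i j k l = Tm b (Equiv.swap 0 s i) (Equiv.swap 0 s j) (Equiv.swap 0 s k) (Equiv.swap 0 s l) := by
  unfold Tm
  conv_rhs => rw [← (swapEquiv s).tsum_eq]
  refine tsum_congr fun n => ?_
  have hc : coef b (swapEquiv s n) = coef b n := by simp only [coef, len_swapEquiv]
  have hm : ∀ m, (((swapEquiv s n).1 (Equiv.swap 0 s m) : ℝ)) = (n.1 m : ℝ) := fun m => by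
    simp [swapEquiv, swapCoord, Equiv.swap_apply_self]
  rw [hc, hm, hm, hm, hm]

/-- `Tm_eq_zero` (docstring added by the landing lane; see the module docstring). [formal bookkeeping] -/
theorem Tm_eq_zero (b : ℝ) (s : Fin 3) {i j k l : Fin 3} (h : sgn s i * sgn s j * sgn s k * sgn s l = -1) : Tm b i j k l = 0 := by
  have := Tm_neg b s i j k l
  rw [h] at this
  push_cast at this
  linarith

/-- Decidable test: some coordinate occurs an odd number of times among `i j k l`. -/
def oddPat (i j k l : Fin 3) : Bool := decide (∃ s : Fin 3, sgn s i * sgn s j * sgn s k * sgn s l = -1)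

/-- ★ ODD MOMENTS VANISH. -/
theorem Tm_eq_zero' (b : ℝ) {i j k l : Fin 3} (h : oddPat i j k l = true) : Tm b i j k l = 0 := by
  obtain ⟨s, hs⟩ := of_decide_eq_true h
  exact Tm_eq_zero b s hs

/-- ★ CUBIC SYMMETRY OF THE EVEN MOMENTS: three equal pure moments `P₄`, three equal mixed moments `P₂₂`. -/
theorem Tm_1111 (b : ℝ) : Tm b 1 1 1 1 = P4 b := by
  have h := Tm_swap b 1 1 1 1 1
  simpa [P4, Equiv.swap_apply_right] using h
/-- `Tm_2222` (docstring added by the landing lane; see the module docstring). [formal bookkeeping] -/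
theorem Tm_2222 (b : ℝ) : Tm b 2 2 2 2 = P4 b := by
  have h := Tm_swap b 2 2 2 2 2
  simpa [P4, Equiv.swap_apply_right] using h
/-- `Tm_0022` (docstring added by the landing lane; see the module docstring). [formal bookkeeping] -/
theorem Tm_0022 (b : ℝ) : Tm b 0 0 2 2 = P22 b := by
  symm
  calc P22 b = Tm b 0 0 1 1 := rfl
    _ = Tm b 2 2 1 1 := by
        have h := Tm_swap b 2 0 0 1 1
        simpa [Equiv.swap_apply_left, Equiv.swap_apply_of_ne_of_ne] using h
    _ = Tm b 2 2 0 0 := by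
        have h := Tm_swap b 1 2 2 1 1
        simpa [Equiv.swap_apply_right, Equiv.swap_apply_of_ne_of_ne] using h
    _ = Tm b 0 0 2 2 := Tm_congr b fun n => by ring
/-- `Tm_1122` (docstring added by the landing lane; see the module docstring). [formal bookkeeping] -/
theorem Tm_1122 (b : ℝ) : Tm b 1 1 2 2 = P22 b := by
  rw [← Tm_0022]
  have h := Tm_swap b 1 1 1 2 2
  simpa [Equiv.swap_apply_right, Equiv.swap_apply_of_ne_of_ne] using h

/-- ★★ THE CLOSED FORM of `Qsum` by cubic symmetry. -/
theorem Qsum_closed (hb : 0 < b) (M : Fin 3 → Fin 3 → ℝ) : Qsum M b =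
    P4 b * (M 0 0 ^ 2 + M 1 1 ^ 2 + M 2 2 ^ 2) + P22 b * (2 * (M 0 0 * M 1 1 + M 0 0 * M 2 2 + M 1 1 * M 2 2) +
      ((M 0 1 + M 1 0) ^ 2 + (M 0 2 + M 2 0) ^ 2 + (M 1 2 + M 2 1) ^ 2)) := by
  have e0101 : Tm b 0 1 0 1 = Tm b 0 0 1 1 := Tm_congr b fun n => by ring
  have e0110 : Tm b 0 1 1 0 = Tm b 0 0 1 1 := Tm_congr b fun n => by ring
  have e0202 : Tm b 0 2 0 2 = Tm b 0 0 2 2 := Tm_congr b fun n => by ring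
  have e0220 : Tm b 0 2 2 0 = Tm b 0 0 2 2 := Tm_congr b fun n => by ring
  have e1001 : Tm b 1 0 0 1 = Tm b 0 0 1 1 := Tm_congr b fun n => by ring
  have e1010 : Tm b 1 0 1 0 = Tm b 0 0 1 1 := Tm_congr b fun n => by ring
  have e1100 : Tm b 1 1 0 0 = Tm b 0 0 1 1 := Tm_congr b fun n => by ring
  have e1212 : Tm b 1 2 1 2 = Tm b 1 1 2 2 := Tm_congr b fun n => by ring
  have e1221 : Tm b 1 2 2 1 = Tm b 1 1 2 2 := Tm_congr b fun n => by ring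
  have e2002 : Tm b 2 0 0 2 = Tm b 0 0 2 2 := Tm_congr b fun n => by ring
  have e2020 : Tm b 2 0 2 0 = Tm b 0 0 2 2 := Tm_congr b fun n => by ring
  have e2112 : Tm b 2 1 1 2 = Tm b 1 1 2 2 := Tm_congr b fun n => by ring
  have e2121 : Tm b 2 1 2 1 = Tm b 1 1 2 2 := Tm_congr b fun n => by ring
  have e2200 : Tm b 2 2 0 0 = Tm b 0 0 2 2 := Tm_congr b fun n => by ring
  have e2211 : Tm b 2 2 1 1 = Tm b 1 1 2 2 := Tm_congr b fun n => by ring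
  rw [Qsum_eq_Tm hb]
  simp only [Fin.sum_univ_three]
  simp (disch := decide) only [Tm_eq_zero' b]
  simp only [e0101, e0110, e0202, e0220, e1001, e1010, e1100, e1212, e1221, e2002, e2020, e2112, e2121, e2200, e2211, Tm_1111, Tm_2222, Tm_0022, Tm_1122]
  simp only [P4, P22]
  ring

/-- ★★★ THE SCALAR CRITERION: `0 ≤ μ₀`, `4 μ₀ N₂ ≤ P₄ − P₂₂` and `4 μ₀ N₂ ≤ 2 P₂₂` imply `StabIneq μ₀ b`
(SOS certificate `4(RHS − LHS) = (P₄ − P₂₂ − λ)Σ M_ii² + P₂₂ (Σ M_ii)² + (2P₂₂ − λ)·Σ_{i<j}(M_ij + M_ji)²/… `, `λ = 4 μ₀ N₂`). -/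
theorem stabIneq_of_scalars {μ₀ : ℝ} (hb : 0 < b) (hμ : 0 ≤ μ₀) (h1 : 4 * μ₀ * N2 b ≤ P4 b - P22 b)
    (h2 : 4 * μ₀ * N2 b ≤ 2 * P22 b) : StabIneq μ₀ b := by
  intro M
  rw [sum_nbhd_field, Qsum_closed hb]
  simp only [Fin.sum_univ_three]
  have hN := N2_nonneg b
  have hlam : 0 ≤ 4 * μ₀ * N2 b := by positivity
  have hP : 0 ≤ P22 b := by linarith
  nlinarith [mul_nonneg (sub_nonneg.2 h1) (sq_nonneg (M 0 0)), mul_nonneg (sub_nonneg.2 h1) (sq_nonneg (M 1 1)),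
    mul_nonneg (sub_nonneg.2 h1) (sq_nonneg (M 2 2)), mul_nonneg hP (sq_nonneg (M 0 0 + M 1 1 + M 2 2)),
    mul_nonneg (sub_nonneg.2 h2) (sq_nonneg (M 0 1 + M 1 0)), mul_nonneg (sub_nonneg.2 h2) (sq_nonneg (M 0 2 + M 2 0)),
    mul_nonneg (sub_nonneg.2 h2) (sq_nonneg (M 1 2 + M 2 1)),
    mul_nonneg hlam (sq_nonneg (M 0 1 - M 1 0)), mul_nonneg hlam (sq_nonneg (M 0 2 - M 2 0)), mul_nonneg hlam (sq_nonneg (M 1 2 - M 2 1))]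

/-- ★★★ … and CONVERSELY the two scalar inequalities are NECESSARY (test `M = diag(1, −1, 0)` and `M = e₀₁ + e₁₀`). -/
theorem scalars_of_stabIneq {μ₀ : ℝ} (hb : 0 < b) (h : StabIneq μ₀ b) :
    4 * μ₀ * N2 b ≤ P4 b - P22 b ∧ 4 * μ₀ * N2 b ≤ 2 * P22 b := by
  constructor
  · have h1 := h (fun i j => if i = 0 ∧ j = 0 then 1 else if i = 1 ∧ j = 1 then -1 else 0)
    rw [sum_nbhd_field, Qsum_closed hb] at h1
    simp only [Fin.sum_univ_three, show ((1 : Fin 3) = 0) = False from propext ⟨by decide, False.elim⟩,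
      show ((2 : Fin 3) = 0) = False from propext ⟨by decide, False.elim⟩, show ((0 : Fin 3) = 1) = False from propext ⟨by decide, False.elim⟩,
      show ((2 : Fin 3) = 1) = False from propext ⟨by decide, False.elim⟩] at h1
    norm_num at h1
    linarith
  · have h1 := h (fun i j => if i = 0 ∧ j = 1 then 1 else if i = 1 ∧ j = 0 then 1 else 0)
    rw [sum_nbhd_field, Qsum_closed hb] at h1
    simp only [Fin.sum_univ_three, show ((1 : Fin 3) = 0) = False from propext ⟨by decide, False.elim⟩,
      show ((2 : Fin 3) = 0) = False from propext ⟨by decide, False.elim⟩, show ((0 : Fin 3) = 1) = False from propext ⟨by decide, False.elim⟩,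
      show ((2 : Fin 3) = 1) = False from propext ⟨by decide, False.elim⟩] at h1
    norm_num at h1
    linarith

/-- ★★★ ON THE STRESS-FREE BRAVAIS REFERENCE: harmonic stability modulo rotations with margin `μ₀ ≥ 0` is EQUIVALENT to the two scalar
lattice-sum inequalities `4 μ₀ N₂(b) ≤ P₄(b) − P₂₂(b)` and `4 μ₀ N₂(b) ≤ 2 P₂₂(b)`. -/
theorem harmStableModRot_iff_scalars {μ₀ : ℝ} (hμ : 0 ≤ μ₀) (hb : 0 < b) (hb2 : 9 / 50 ≤ b ^ 2) (hS : ∀ j k, S b j k = 0) :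
    HarmStableModRot μ₀ (fccRef b hb) ↔ 4 * μ₀ * N2 b ≤ P4 b - P22 b ∧ 4 * μ₀ * N2 b ≤ 2 * P22 b := by
  rw [harmStableModRot_iff_stabIneq hμ hb hb2 hS]
  exact ⟨scalars_of_stabIneq hb, fun h => stabIneq_of_scalars hb hμ h.1 h.2⟩

end Scalars

/-! ## §K8 At the stress-free spacing `a₀`: the EQUIVALENCES -/

section AtA0Iff

/-- ★★★ `HarmStableModRot μ₀ (fccRef a₀) ↔ StabIneq μ₀ a₀` for every margin `μ₀ ≥ 0`. -/
theorem harmStableModRot_fcc_a0_iff {μ₀ : ℝ} (hμ : 0 ≤ μ₀) : HarmStableModRot μ₀ (fccRef a0 a0_pos) ↔ StabIneq μ₀ a0 :=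
  harmStableModRot_iff_stabIneq hμ a0_pos a0_sq_ge S_a0_eq_zero

/-- ★★★ … `↔ 4 μ₀ N₂(a₀) ≤ P₄(a₀) − P₂₂(a₀) ∧ 4 μ₀ N₂(a₀) ≤ 2 P₂₂(a₀)`: census STAB-61 IS the pair of scalar inequalities
`N₂(a₀)/25 ≤ P₄(a₀) − P₂₂(a₀)` and `N₂(a₀)/25 ≤ 2 P₂₂(a₀)` (floating point: `1.81 ≤ 6.87` and `1.81 ≤ 18.4`). -/
theorem harmStableModRot_fcc_a0_iff_scalars {μ₀ : ℝ} (hμ : 0 ≤ μ₀) :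
    HarmStableModRot μ₀ (fccRef a0 a0_pos) ↔ 4 * μ₀ * N2 a0 ≤ P4 a0 - P22 a0 ∧ 4 * μ₀ * N2 a0 ≤ 2 * P22 a0 :=
  harmStableModRot_iff_scalars hμ a0_pos a0_sq_ge S_a0_eq_zero

/-- ★★★ THE TYPED SUCCESSOR OF STAB-61: the complete hypothesis block of (H𝄪ʳ) at the record dials from TWO SCALAR LATTICE-SUM INEQUALITIES. -/
theorem exists_admissible_harmStableModRot_of_scalars (h1 : 4 * (1 / 100) * N2 a0 ≤ P4 a0 - P22 a0) (h2 : 4 * (1 / 100) * N2 a0 ≤ 2 * P22 a0) :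
    ∃ P : PeriodicConfiguration 3,
      IsSeparatedRef (3 / 5) P ∧ IsLabelledRef (1 / 3) 3 P ∧ IsForceFree P ∧ IsStressFree P ∧ HarmStableModRot (1 / 100) P :=
  exists_admissible_harmStableModRot_of (stabIneq_of_scalars a0_pos (by norm_num) h1 h2)

end AtA0Iff

end Fcc

end Summit.AtomisticToContinuum.Crystallization.Theorems.ChargedEnergyGapChartDial

end
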